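import Summits.HodgeConjecture.CorCM.Census.CyclicCharacterEvenEquator

/-!
# Cyclic characters, XXVIa: the `2ᵏ⁻¹ + 1` near blocks from TWO kernel elements (elementary-abelian kernels included)

COR-CM (cell `pub-hodgecm2`), count-neutral kernel combinatorics by the binder seat b09 (gen 43; lane CYCLIC-CHARACTER FIBRE LAW, part XXVIa), on gen 41ʼs part VIII
(`Census/CyclicCharacterNearZone.lean`) and gen 42ʼs part XXIII §1 BY NAME — their proofs verbatim with the pigeonhole run on `g, g·n, g·n'` for two distinct
non-trivial kernel elements `n ≠ n'` instead of `g, g·n, g·n²` (which needs `n² ≠ 1`).  Theorems only (no definition, no `decide`, no certificate, no named fact,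
no `sorry`).  HONEST FRAMING: `HC_CM` is NOT proved, here or anywhere in the tree; nothing here is a period or a headline.

WHY.  The near-block count `2ᵏ⁻¹ + 1 ≤ #{blocks of potential ≤ 1}` of part XXIII (`half_add_one_le_card_filter_bpot_le_one`) asks for a kernel element of
order `≥ 3`; an EVEN kernel may be elementary abelian (`ℤ/2 × ℤ/2 ⊂ D₄ ×_ε ℤ/4`, …).  With `|ker w| ≥ 3` two distinct non-trivial kernel elements always exist,
and they suffice: `exists_mem_symmDiff_notMem'`, `eq_of_oflipCM_arcType_eq'`, `two_nsmul_eq_of_rt_oflipCM_arcType_eq'`, `blk_oflipCM_arcType_eq_iff'`,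
`half_add_one_le_card_filter_bpot_le_one'`.  Parts XXVI/XXVIII use the primed count, so the even laws carry no order hypothesis.

## References
* [Pohlmann1968] H. Pohlmann, Algebraic cycles on abelian varieties of complex multiplication type, Ann. of Math. 88 (1968), Thm 1.
-/

namespace Summit.HodgeConjecture.CorCM.Census.CyclicCharacter

open Finset
open Summit.HodgeConjecture.CorCM.Prior.AllgGroup.RfwfAllgGroup
open Summit.HodgeConjecture.CorCM.Census.BlockParity
open Summit.HodgeConjecture.CorCM.Census.Coinvariant
open Summit.HodgeConjecture.CorCM.Census.TwistGeneration
open Summit.HodgeConjecture.CorCM.Census.Nondegenerate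
open Summit.HodgeConjecture.CorCM.Census.BaseBlock

noncomputable section

variable {G : Type*} [Group G] [Fintype G] [DecidableEq G] {k : ℕ} {w : G → ZMod (2 ^ k)} {c : G}

/-- **Two kernel elements off two places** (primed form of part VIII): for distinct non-trivial kernel elements `n ≠ n'` and `a ≠ b` there is a point where
`T_a`, `T_b` differ, off the places of `t` and `s`. [folklore] -/
theorem exists_mem_symmDiff_notMem' (hw : ∀ P Q : G, w (P * Q) = w P + w Q) (hk : 1 ≤ k) (hc2 : c * c = 1)
    (hwc : w c ≠ 0) {n n' : G} (hn1 : n ≠ 1) (hn'1 : n' ≠ 1) (hnn' : n ≠ n') (hn : w n = 0) (hn' : w n' = 0) {a b : ZMod (2 ^ k)} (hab : a ≠ b)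
    (h1 : ∃ g₁ : G, w g₁ = 1) (t s : G) : ∃ x : G, ¬ (x ∈ (arcType hw hk hc2 hwc a).1 ↔ x ∈ (arcType hw hk hc2 hwc b).1) ∧ x ∉ orb c t ∧ x ∉ orb c s := by
  have hne : arcType hw hk hc2 hwc a ≠ arcType hw hk hc2 hwc b := fun h => hab (arcType_injective hw hk hc2 hwc h1 h)
  obtain ⟨g, hg⟩ : ∃ g : G, ¬ (g ∈ (arcType hw hk hc2 hwc a).1 ↔ g ∈ (arcType hw hk hc2 hwc b).1) := by
    by_contra hall
    push Not at hall
    exact hne (Subtype.ext (Finset.ext hall))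
  have hdiff : ∀ m : G, w m = 0 → ¬ (g * m ∈ (arcType hw hk hc2 hwc a).1 ↔ g * m ∈ (arcType hw hk hc2 hwc b).1) := by
    intro m hm
    rw [mul_mem_arcType_iff hw hk hc2 hwc a hm, mul_mem_arcType_iff hw hk hc2 hwc b hm]
    exact hg
  have key : ∀ m m' : G, w m = 0 → w m' = 0 → g * m ≠ c * (g * m') := by
    intro m m' hm hm' h
    apply hwc
    have : c = g * m * (g * m')⁻¹ := by rw [h, mul_inv_cancel_right]
    rw [this, hw, map_inv hw, hw, hw, hm, hm']
    abel
  have one_per_orb : ∀ u m m' : G, w m = 0 → w m' = 0 → g * m ∈ orb c u → g * m' ∈ orb c u → m = m' := by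
    intro u m m' hm hm' h h'
    rw [mem_orb] at h h'
    rcases h with h | h <;> rcases h' with h' | h'
    · exact mul_left_cancel (h.trans h'.symm)
    · exact absurd (h'.trans ((congrArg (c * ·) h).symm)) (key m' m hm' hm)
    · exact absurd (h.trans ((congrArg (c * ·) h').symm)) (key m m' hm hm')
    · exact mul_left_cancel (h.trans h'.symm)
  have hn_ne : (1 : G) ≠ n := fun e => hn1 e.symm
  have h1n' : (1 : G) ≠ n' := fun e => hn'1 e.symm
  by_contra hnone
  have hforce : ∀ x : G, ¬ (x ∈ (arcType hw hk hc2 hwc a).1 ↔ x ∈ (arcType hw hk hc2 hwc b).1) → x ∉ orb c t → x ∈ orb c s :=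
    fun x hx hxt => by
      by_contra hxs
      exact hnone ⟨x, hx, hxt, hxs⟩
  have h0 := hforce (g * 1) (hdiff 1 (map_one hw))
  have h1' := hforce (g * n) (hdiff n hn)
  have h2 := hforce (g * n') (hdiff n' hn')
  rcases em (g * 1 ∈ orb c t) with ht0 | ht0 <;> rcases em (g * n ∈ orb c t) with ht1 | ht1 <;>
    rcases em (g * n' ∈ orb c t) with ht2 | ht2
  · exact hn_ne (one_per_orb t 1 n (map_one hw) hn ht0 ht1)
  · exact hn_ne (one_per_orb t 1 n (map_one hw) hn ht0 ht1)
  · exact h1n' (one_per_orb t 1 n' (map_one hw) hn' ht0 ht2)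
  · exact hnn' (one_per_orb s n n' hn hn' (h1' ht1) (h2 ht2))
  · exact hnn' (one_per_orb t n n' hn hn' ht1 ht2)
  · exact h1n' (one_per_orb s 1 n' (map_one hw) hn' (h0 ht0) (h2 ht2))
  · exact hn_ne (one_per_orb s 1 n (map_one hw) hn (h0 ht0) (h1' ht1))
  · exact hn_ne (one_per_orb s 1 n (map_one hw) hn (h0 ht0) (h1' ht1))

/-- **A single flip determines its centre** (primed form): `T_a^{(t)} = T_b^{(s)} ⇒ a = b`, given two distinct non-trivial kernel elements. [folklore] -/
theorem eq_of_oflipCM_arcType_eq' (hw : ∀ P Q : G, w (P * Q) = w P + w Q) (hk : 1 ≤ k) (hc2 : c * c = 1)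
    (hwc : w c ≠ 0) {n n' : G} (hn1 : n ≠ 1) (hn'1 : n' ≠ 1) (hnn' : n ≠ n') (hn : w n = 0) (hn' : w n' = 0) (h1 : ∃ g₁ : G, w g₁ = 1)
    {a b : ZMod (2 ^ k)} {t s : G} (h : oflipCM c hc2 t (arcType hw hk hc2 hwc a) = oflipCM c hc2 s (arcType hw hk hc2 hwc b)) : a = b := by
  by_contra hab
  obtain ⟨x, hx, hxt, hxs⟩ := exists_mem_symmDiff_notMem' hw hk hc2 hwc hn1 hn'1 hnn' hn hn' hab h1 t s
  have e := congrArg (fun Ψ : CMF G c => x ∈ Ψ.1) h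
  simp only [mem_oflipCM_iff', eq_iff_iff] at e
  tauto

/-- Types in one block have the same doubled invariant (primed form). [folklore] -/
theorem two_nsmul_eq_of_rt_oflipCM_arcType_eq' (hw : ∀ P Q : G, w (P * Q) = w P + w Q) (hk : 1 ≤ k) (hc2 : c * c = 1)
    (hwc : w c ≠ 0) {n n' : G} (hn1 : n ≠ 1) (hn'1 : n' ≠ 1) (hnn' : n ≠ n') (hn : w n = 0) (hn' : w n' = 0) (h1 : ∃ g₁ : G, w g₁ = 1)
    {a b : ZMod (2 ^ k)} {t s Q : G}
    (h : rt c Q (oflipCM c hc2 t (arcType hw hk hc2 hwc a)) = oflipCM c hc2 s (arcType hw hk hc2 hwc b)) : 2 • (w t - a) = 2 • (w s - b) := by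
  rw [rt_oflipCM_arcType] at h
  have hab : a - w Q = b := eq_of_oflipCM_arcType_eq' hw hk hc2 hwc hn1 hn'1 hnn' hn hn' h1 h
  rw [hab] at h
  have horb := mem_orb_of_oflipCM_arcType_eq hw hk hc2 hwc h
  rw [← flip_invariant hw Q t a, hab]
  rw [mem_orb] at horb
  rcases horb with h' | h'
  · rw [h']
  · rw [h', two_nsmul_flip_invariant_cmul hw hk hc2 hwc]

/-- **THE BLOCKS OF THE SINGLE FLIPS** (primed form): `T_a^{(t)}` and `T_b^{(s)}` lie in the same block iff `2·(w t − a) = 2·(w s − b)`. [folklore] -/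
theorem blk_oflipCM_arcType_eq_iff' (hw : ∀ P Q : G, w (P * Q) = w P + w Q) (hk : 1 ≤ k) (hc2 : c * c = 1)
    (hwc : w c ≠ 0) {n n' : G} (hn1 : n ≠ 1) (hn'1 : n' ≠ 1) (hnn' : n ≠ n') (hn : w n = 0) (hn' : w n' = 0) (h1 : ∃ g₁ : G, w g₁ = 1)
    (a b : ZMod (2 ^ k)) (t s : G) :
    blk c (oflipCM c hc2 t (arcType hw hk hc2 hwc a)) = blk c (oflipCM c hc2 s (arcType hw hk hc2 hwc b)) ↔ 2 • (w t - a) = 2 • (w s - b) := by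
  constructor
  · intro h
    obtain ⟨Q, hQ⟩ := exists_rt_eq_of_blk_eq c h
    exact two_nsmul_eq_of_rt_oflipCM_arcType_eq' hw hk hc2 hwc hn1 hn'1 hnn' hn hn' h1 hQ
  · intro h
    obtain ⟨Q, hQ⟩ := exists_rt_oflipCM_arcType_eq hw hk hc2 hwc h
    rw [← hQ, blk_rt]

/-- **AT LEAST `2ᵏ⁻¹ + 1` NEAR BLOCKS** (primed form): the arc block and the blocks of the flips of `T_0` at the positions `0, …, 2ᵏ⁻¹ − 1` are pairwise distinct,
given two distinct non-trivial kernel elements (`w` onto, `c` central). [folklore] -/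
theorem half_add_one_le_card_filter_bpot_le_one' (hw : ∀ P Q : G, w (P * Q) = w P + w Q) (hk : 1 ≤ k) (hc2 : c * c = 1)
    (hcen : ∀ x : G, x * c = c * x) (hwc : w c ≠ 0) (h1 : ∃ g₁ : G, w g₁ = 1) {n₀ n₁ : G} (hn₀1 : n₀ ≠ 1) (hn₁1 : n₁ ≠ 1) (hn₀₁ : n₀ ≠ n₁)
    (hn₀ : w n₀ = 0) (hn₁ : w n₁ = 0) :
    2 ^ (k - 1) + 1 ≤ (univ.filter fun Bk : Block c => bpot c (arcType hw hk hc2 hwc 0) Bk.out ≤ 1).card := by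
  have h2k : 2 ^ k = 2 * 2 ^ (k - 1) := by rw [← pow_succ', Nat.sub_add_cancel hk]
  have hpt : ∀ j : ℕ, ∃ u : G, w u = (j : ZMod (2 ^ k)) := fun j => exists_apply_eq hw h1 _
  choose pt hpt using hpt
  set blkAt : ℕ → Block c := fun j => blk c (oflipCM c hc2 (pt j) (arcType hw hk hc2 hwc 0)) with hblkAt
  have hinj : Set.InjOn blkAt ↑(range (2 ^ (k - 1))) := by
    intro j hj j' hj' h
    have hj : j < 2 ^ (k - 1) := mem_range.mp hj
    have hj' : j' < 2 ^ (k - 1) := mem_range.mp hj'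
    have h2 := (blk_oflipCM_arcType_eq_iff' hw hk hc2 hwc hn₀1 hn₁1 hn₀₁ hn₀ hn₁ h1 0 0 (pt j) (pt j')).mp h
    rw [hpt, hpt, sub_zero, sub_zero, two_nsmul, two_nsmul, ← Nat.cast_add, ← Nat.cast_add] at h2
    have h3 := congrArg ZMod.val h2
    rw [val_natCast_of_lt (by omega), val_natCast_of_lt (by omega)] at h3
    omega
  have hpot1 : ∀ j < 2 ^ (k - 1), bpot c (arcType hw hk hc2 hwc 0) (blkAt j).out = 1 := fun j hj => by
    rw [hblkAt, bpot_out]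
    exact bpot_oflipCM_arcType_eq_one hw hk hc2 hcen hwc hn₀1 hn₀ (mem_arcType_of_apply_eq_natCast hw hk hc2 hwc (hpt j) hj).1
  have hpot0 : bpot c (arcType hw hk hc2 hwc 0) (blk c (arcType hw hk hc2 hwc 0)).out = 0 := by
    rw [bpot_out]; have := bpot_rt_base c (arcType hw hk hc2 hwc 0) 1; rwa [rt_one] at this
  have hnot : blk c (arcType hw hk hc2 hwc 0) ∉ (range (2 ^ (k - 1))).image blkAt := by
    rw [mem_image]
    rintro ⟨j, hj, h⟩
    have := hpot1 j (mem_range.mp hj)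
    rw [h, hpot0] at this
    exact zero_ne_one this
  calc 2 ^ (k - 1) + 1 = (insert (blk c (arcType hw hk hc2 hwc 0)) ((range (2 ^ (k - 1))).image blkAt)).card := by
        rw [card_insert_of_notMem hnot, card_image_of_injOn hinj, card_range]
    _ ≤ _ := card_le_card fun B hB => by
        rw [mem_filter]
        refine ⟨mem_univ _, ?_⟩
        rcases mem_insert.mp hB with rfl | hB
        · rw [hpot0]; exact Nat.zero_le 1
        · obtain ⟨j, hj, rfl⟩ := mem_image.mp hB
          rw [hpot1 j (mem_range.mp hj)]

/-- **Two distinct non-trivial kernel elements from an even kernel of size `≥ 4`** (indeed from `|ker w| ≥ 3`). [folklore] -/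
theorem exists_two_ker (hw : ∀ P Q : G, w (P * Q) = w P + w Q) (h3 : 3 ≤ (univ.filter fun s : G => w s = 0).card) :
    ∃ n₀ n₁ : G, n₀ ≠ 1 ∧ n₁ ≠ 1 ∧ n₀ ≠ n₁ ∧ w n₀ = 0 ∧ w n₁ = 0 := by
  have h1F : (1 : G) ∈ univ.filter fun s : G => w s = 0 := mem_filter.mpr ⟨mem_univ _, map_one hw⟩
  have hc : 1 < ((univ.filter fun s : G => w s = 0).erase 1).card := by have := card_erase_add_one h1F; omega
  obtain ⟨n₀, hn₀, n₁, hn₁, hne⟩ := one_lt_card.mp hc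
  exact ⟨n₀, n₁, ne_of_mem_erase hn₀, ne_of_mem_erase hn₁, hne, (mem_filter.mp (mem_of_mem_erase hn₀)).2, (mem_filter.mp (mem_of_mem_erase hn₁)).2⟩

end

end Summit.HodgeConjecture.CorCM.Census.CyclicCharacter
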